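import Summits.QuantumFields.BalabanUV.T4Continuum.Support.NE7CurvedExactLift
import Summits.QuantumFields.BalabanUV.T4Continuum.Support.NE7ExactLiftCurlLetter
import Summits.QuantumFields.BalabanUV.T4Continuum.Support.NE3CovLiftCurl
import Summits.QuantumFields.BalabanUV.T4Continuum.Support.NE3SpreadLiftCurl
import HarnessLib

/-!
# NE7CurvedExactLiftCurl — THE ONE-STEP CURL LETTER (L2_W) OF THE CURVED EXACT LIFT: the dressed curl energy of `r_W w` at the fine background `W` is controlled by the dressed curl energy
# of the datum `w` at the coarse background `W̄ = cavg 2 W` plus `O((x + b)²)·‖w‖²`: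
# **`curlSq W (r_W w) [0,2N)⁴ ≤ 8192·curlSq W̄ w [0,N)⁴ + curlRemC(x,b)·dirSq w [0,N)⁴`** (`d = 4`, `L = 2`; `b` = bondwise radius of `W`, displayed)
# (lineage `b2b-balaban-t4-ne7b-p1`, gen 163; route (H′), memo `t4/b2b-balaban-t4-ne7b-p1/g162/records/SCOPING-LEVELMASSES.md` §8 (L2) + `g163/records/SCOPING-R4.md` §3)

Cell `pub-balaban`, rung (B)+1 sub-cell t4, lineage `b2b-balaban-t4-ne7b-p1` (row NE7b OWNER + CRUX PROVER; junction service for row NE7 on ROAD-G116 §6 (G3) ∕ the ℓ² route to (G′)),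
generation 163.
WHY.  In the root-form budget the slice masses `‖J_k‖ ≤ L√C_P·(√curlSq_{W_k}(X′_k) + √curlSq_{W_k}(r_k X′_{k+1}))` (✓ `NE7OneLevelSliceStep.sliceStep_letters`) need the curl energy of the
ONE-STEP lift controlled by the COARSE curl energy of its datum — at the curved backgrounds of the tower.  Flat: ✓ `NE7ExactLiftCurlLetter` (`≤ 1024·curlSq_1 w`).  THIS FILE dresses it:
dressed vs flat curl differ pointwise by `16·δ·(local size)` at a background with bondwise radius `δ` (✓ `NE3CovLiftCurl.norm_curlAt_sub_flat_le`), in `ℓ²` by `8192·d·δ²·dirSq`; the curved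
correction `R₀^W(δ_W)` has curl energy `≤ liftCurlC·dirSq δ_W` (✓ `curlSq_rightInvW0_class_le`) and `dirSq δ_W = O((x+b)²)‖r w‖²` (✓ `NE7CurvedPushDefectLetter`); the coarse background's
bondwise radius is `≤ 64·5·8·4·x + 2b` (✓ `norm_bavg_sub_one_le_of_bonds'`).
WHAT ([folklore]; DATA def `curlRemC`; 0 sorry): §1 (every `d`) `curlSq_sub_le`, **`curlSq_sub_flat_le`** (`Σ‖curl_V ψ − curl_1 ψ‖² ≤ 4096·d·δ²·dirSq ψ` on the period box),
`curlSq_le_two_flat`, `curlSq_flat_le_two`; §2 (`d = 4`, `L = 2`) **`curlSq_curvedLift_le`**.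
WHAT IS NOT HERE: (K), (G3).
HONEST FRAMING (page 1): elementary inequalities over kernel theorems about OUR lifts; bondwise radius displayed; nothing of Bałaban's asserted; NOT (G3), NOT (G′), NOT NE7∕NE3 as spine nodes;
row NE7b NOT PRINTED ∕ NOT PROVED; spine 0∕9; finite T⁴ rung (B)+1 — NOT infinite volume, NOT mass gap, NOT BetaPertH, NOT Clay.
-/

set_option autoImplicit false

open scoped BigOperators Matrix Matrix.Norms.L2Operator
open Finset

namespace Summit.QuantumFields.BalabanUV.T4Continuum.NE7CurvedExactLiftCurl

open Literature.MathematicalPhysics.QuantumFieldTheory.Balaban1983to89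
open B7Prop1Explicit B7Prop2Explicit
open T4AveragingDeficitWall (IsUnitaryCfg IsSkewDir SmallField dirSq curl curlAt curlSq)
open T4AveragingDeficitWallBoundary (IsPeriodicCfg periodBox sum_periodBox_shift)
open AveragingDeficitPeriodicCounting (IsPeriodicDir)
open AveragingDeficitTwoLevelPrep (prop1Radius)
open AveragingDeficitMultiLevelPrep (cpush tower LevelSmall)
open AveragingDeficitChartCalculus (cavg)
open BlockAveragePushDirSplit (flat)
open MinimalActionWitness (flatCfg)
open SpreadLift (loopRad)
open NE3QbarIterCovLiftPrep (cruxC)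
open NE3RightInverseSolveLetters (thetaLoc)
open NE3TangentCovariantTower (step_small)
open NE3TangentFlatPush (flatCfg_eq_flat)
open NE3CovLiftCurl (norm_curlAt_sub_flat_le)
open NE3SpreadLiftCurl (sum_plane_pair_le)
open NE3LiftDefectCorrection (sqrt_curlSq_add_le)
open NE3EnergyHessContTwoTerm (dirSq_nonneg curlSq_nonneg)
open NE7OneLevelSliceStep (sqrt_curlSq_sub_le curlSq_neg)
open NE7FrameFreeRightInverse (rightInvW0)
open NE7SliceRepHessianFloor (liftCurlC liftCurlC_nonneg curlSq_rightInvW0_class_le)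
open NE7ExactLiftGaugePart (exactLift cpush_exactLift exactLift_periodic)
open NE7ExactLiftComposites (liftIter rho rho_nonneg Kmain Dgauge Kmain_nonneg Dgauge_nonneg dirSq_liftIter_le)
open NE7ExactLiftCurlLetter (curlSq_exactLift_le_four_two)
open NE7CurvedPushDefectLetter (defA defB defC defA_nonneg defB_nonneg defC_nonneg dirSq_cpush_sub_cpush_flat_le norm_bavg_sub_one_le_of_bonds')
open NE7CurvedExactLift (defect curvedLift isSkewDir_defect)

noncomputable section

variable {d : ℕ} {n : Type*} [Fintype n] [DecidableEq n]

/-! ## §1 Dressed versus flat curl energy at a background with bondwise radius `δ` -/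

/-- `curlSq V (ψ − η) F ≤ 2·curlSq V ψ F + 2·curlSq V η F`. [folklore] -/
theorem curlSq_sub_le (V : Site d → Fin d → (Matrix n n ℂ)ˣ) (ψ η : Site d → Fin d → Matrix n n ℂ) (F : Finset (Site d)) :
    curlSq V (ψ - η) F ≤ 2 * curlSq V ψ F + 2 * curlSq V η F := by
  have h := sqrt_curlSq_sub_le V ψ η F
  have h0 := curlSq_nonneg V (ψ - η) F
  have h1 := curlSq_nonneg V ψ F
  have h2 := curlSq_nonneg V η F
  have hsq := pow_le_pow_left₀ (Real.sqrt_nonneg _) h 2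
  rw [Real.sq_sqrt h0] at hsq
  nlinarith [Real.sq_sqrt h1, Real.sq_sqrt h2, Real.sqrt_nonneg (curlSq V ψ F), Real.sqrt_nonneg (curlSq V η F),
    sq_nonneg (Real.sqrt (curlSq V ψ F) - Real.sqrt (curlSq V η F))]

/-- **DRESSED MINUS FLAT CURL IN `ℓ²`** (`V` unitary with `‖V(x,μ) − 1‖ ≤ δ` everywhere, `ψ` `P`-periodic, `P ≥ 1`):
`Σ_{x∈[0,P)^d} Σ_π ‖curl_V ψ (x,π) − curl_1 ψ (x,π)‖² ≤ 4096·d·δ²·dirSq ψ [0,P)^d`. [folklore] -/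
theorem curlSq_sub_flat_le [Nonempty n] {V : Site d → Fin d → (Matrix n n ℂ)ˣ} (hV : IsUnitaryCfg V) {δ : ℝ} (hδ : 0 ≤ δ)
    (hVδ : ∀ (x : Site d) (μ : Fin d), ‖((V x μ : (Matrix n n ℂ)ˣ) : Matrix n n ℂ) - 1‖ ≤ δ) {P : ℕ} (hP : 1 ≤ P)
    {ψ : Site d → Fin d → Matrix n n ℂ} (hψ : IsPeriodicDir ψ (P : ℤ)) :
    ∑ x ∈ periodBox (d := d) P, ∑ π : T4AveragingDeficitWall.Plane d, ‖curl V ψ (x, π) - curl (flat (d := d) (n := n)) ψ (x, π)‖ ^ 2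
      ≤ 4096 * d * δ ^ 2 * dirSq ψ (periodBox (d := d) P) := by
  -- pointwise
  have hpt : ∀ (x : Site d) (π : T4AveragingDeficitWall.Plane d),
      ‖curl V ψ (x, π) - curl (flat (d := d) (n := n)) ψ (x, π)‖ ^ 2
        ≤ 1024 * δ ^ 2 * (‖ψ x π.1.1‖ ^ 2 + ‖ψ (x + e π.1.1) π.1.2‖ ^ 2 + ‖ψ (x + e π.1.2) π.1.1‖ ^ 2 + ‖ψ x π.1.2‖ ^ 2) := by
    intro x π
    set s : ℝ := ‖ψ x π.1.1‖ + ‖ψ (x + e π.1.1) π.1.2‖ + ‖ψ (x + e π.1.2) π.1.1‖ + ‖ψ x π.1.2‖ with hs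
    have ha := norm_nonneg (ψ x π.1.1); have hb := norm_nonneg (ψ (x + e π.1.1) π.1.2)
    have hc := norm_nonneg (ψ (x + e π.1.2) π.1.1); have hd' := norm_nonneg (ψ x π.1.2)
    have h := norm_curlAt_sub_flat_le hV ψ x π.1.1 π.1.2 hδ (hVδ _ _) (hVδ _ _) (hVδ _ _)
      (show ‖ψ x π.1.1‖ ≤ s by rw [hs]; linarith) (show ‖ψ (x + e π.1.1) π.1.2‖ ≤ s by rw [hs]; linarith)
      (show ‖ψ (x + e π.1.2) π.1.1‖ ≤ s by rw [hs]; linarith) (show ‖ψ x π.1.2‖ ≤ s by rw [hs]; linarith)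
    have hs2 : s ^ 2 ≤ 4 * (‖ψ x π.1.1‖ ^ 2 + ‖ψ (x + e π.1.1) π.1.2‖ ^ 2 + ‖ψ (x + e π.1.2) π.1.1‖ ^ 2 + ‖ψ x π.1.2‖ ^ 2) := by
      rw [hs]
      nlinarith [sq_nonneg (‖ψ x π.1.1‖ - ‖ψ (x + e π.1.1) π.1.2‖), sq_nonneg (‖ψ x π.1.1‖ - ‖ψ (x + e π.1.2) π.1.1‖), sq_nonneg (‖ψ x π.1.1‖ - ‖ψ x π.1.2‖),
        sq_nonneg (‖ψ (x + e π.1.1) π.1.2‖ - ‖ψ (x + e π.1.2) π.1.1‖), sq_nonneg (‖ψ (x + e π.1.1) π.1.2‖ - ‖ψ x π.1.2‖), sq_nonneg (‖ψ (x + e π.1.2) π.1.1‖ - ‖ψ x π.1.2‖)]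
    have h2 : ‖curl V ψ (x, π) - curl (flat (d := d) (n := n)) ψ (x, π)‖ ^ 2 ≤ (16 * δ * s) ^ 2 := pow_le_pow_left₀ (norm_nonneg _) h 2
    nlinarith [h2, hs2, sq_nonneg δ]
  -- the four shifted masses
  set h : Fin d → ℝ := fun κ => ∑ x ∈ periodBox (d := d) P, ‖ψ x κ‖ ^ 2 with hh
  have hh0 : ∀ κ, 0 ≤ h κ := fun κ => Finset.sum_nonneg fun _ _ => sq_nonneg _
  have hshift : ∀ μ κ : Fin d, ∑ x ∈ periodBox (d := d) P, ‖ψ (x + e μ) κ‖ ^ 2 = h κ :=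
    fun μ κ => sum_periodBox_shift P hP (g := fun x => ‖ψ x κ‖ ^ 2) (fun x j => by simp only [hψ x j κ]) (e μ)
  have hdir : dirSq ψ (periodBox (d := d) P) = ∑ κ, h κ := by unfold dirSq; rw [Finset.sum_comm]
  calc ∑ x ∈ periodBox (d := d) P, ∑ π : T4AveragingDeficitWall.Plane d, ‖curl V ψ (x, π) - curl (flat (d := d) (n := n)) ψ (x, π)‖ ^ 2
      ≤ ∑ x ∈ periodBox (d := d) P, ∑ π : T4AveragingDeficitWall.Plane d,
          1024 * δ ^ 2 * (‖ψ x π.1.1‖ ^ 2 + ‖ψ (x + e π.1.1) π.1.2‖ ^ 2 + ‖ψ (x + e π.1.2) π.1.1‖ ^ 2 + ‖ψ x π.1.2‖ ^ 2) :=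
        Finset.sum_le_sum fun x _ => Finset.sum_le_sum fun π _ => hpt x π
    _ = 1024 * δ ^ 2 * ∑ π : T4AveragingDeficitWall.Plane d, (2 * h π.1.1 + 2 * h π.1.2) := by
        rw [Finset.sum_comm, Finset.mul_sum]
        refine Finset.sum_congr rfl fun π _ => ?_
        rw [← Finset.mul_sum]
        simp only [Finset.sum_add_distrib, hshift, hh]
        ring
    _ ≤ 1024 * δ ^ 2 * (2 * (2 * d * ∑ κ, h κ)) := by
        refine mul_le_mul_of_nonneg_left ?_ (by positivity)
        have hp := sum_plane_pair_le (d := d) (h := fun κ => h κ) hh0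
        have : ∑ π : T4AveragingDeficitWall.Plane d, (2 * h π.1.1 + 2 * h π.1.2) = 2 * ∑ π : T4AveragingDeficitWall.Plane d, (h π.1.1 + h π.1.2) := by
          rw [Finset.mul_sum]; exact Finset.sum_congr rfl fun π _ => by ring
        rw [this]; linarith
    _ = 4096 * d * δ ^ 2 * dirSq ψ (periodBox (d := d) P) := by rw [hdir]; ring

/-- **DRESSED ≤ 2·FLAT + O(δ²)·MASS**: `curlSq V ψ [0,P)^d ≤ 2·curlSq 1 ψ [0,P)^d + 8192·d·δ²·dirSq ψ [0,P)^d`. [folklore] -/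
theorem curlSq_le_two_flat [Nonempty n] {V : Site d → Fin d → (Matrix n n ℂ)ˣ} (hV : IsUnitaryCfg V) {δ : ℝ} (hδ : 0 ≤ δ)
    (hVδ : ∀ (x : Site d) (μ : Fin d), ‖((V x μ : (Matrix n n ℂ)ˣ) : Matrix n n ℂ) - 1‖ ≤ δ) {P : ℕ} (hP : 1 ≤ P)
    {ψ : Site d → Fin d → Matrix n n ℂ} (hψ : IsPeriodicDir ψ (P : ℤ)) :
    curlSq V ψ (periodBox (d := d) P) ≤ 2 * curlSq (flat (d := d) (n := n)) ψ (periodBox (d := d) P) + 8192 * d * δ ^ 2 * dirSq ψ (periodBox (d := d) P) := by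
  have hD := curlSq_sub_flat_le hV hδ hVδ hP hψ
  unfold curlSq at hD ⊢
  have hpt : ∀ (x : Site d) (π : T4AveragingDeficitWall.Plane d),
      ‖curl V ψ (x, π)‖ ^ 2 ≤ 2 * ‖curl (flat (d := d) (n := n)) ψ (x, π)‖ ^ 2 + 2 * ‖curl V ψ (x, π) - curl (flat (d := d) (n := n)) ψ (x, π)‖ ^ 2 := by
    intro x π
    have h := norm_add_le (curl (flat (d := d) (n := n)) ψ (x, π)) (curl V ψ (x, π) - curl (flat (d := d) (n := n)) ψ (x, π))
    rw [add_sub_cancel] at h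
    nlinarith [h, norm_nonneg (curl V ψ (x, π)), norm_nonneg (curl (flat (d := d) (n := n)) ψ (x, π)), norm_nonneg (curl V ψ (x, π) - curl (flat (d := d) (n := n)) ψ (x, π)),
      sq_nonneg (‖curl (flat (d := d) (n := n)) ψ (x, π)‖ - ‖curl V ψ (x, π) - curl (flat (d := d) (n := n)) ψ (x, π)‖)]
  calc ∑ z ∈ periodBox (d := d) P, ∑ π : T4AveragingDeficitWall.Plane d, ‖curl V ψ (z, π)‖ ^ 2
      ≤ ∑ z ∈ periodBox (d := d) P, ∑ π : T4AveragingDeficitWall.Plane d,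
          (2 * ‖curl (flat (d := d) (n := n)) ψ (z, π)‖ ^ 2 + 2 * ‖curl V ψ (z, π) - curl (flat (d := d) (n := n)) ψ (z, π)‖ ^ 2) :=
        Finset.sum_le_sum fun z _ => Finset.sum_le_sum fun π _ => hpt z π
    _ = 2 * ∑ z ∈ periodBox (d := d) P, ∑ π : T4AveragingDeficitWall.Plane d, ‖curl (flat (d := d) (n := n)) ψ (z, π)‖ ^ 2
        + 2 * ∑ z ∈ periodBox (d := d) P, ∑ π : T4AveragingDeficitWall.Plane d, ‖curl V ψ (z, π) - curl (flat (d := d) (n := n)) ψ (z, π)‖ ^ 2 := by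
        simp only [Finset.sum_add_distrib, Finset.mul_sum]
    _ ≤ _ := by nlinarith [hD]

/-- **FLAT ≤ 2·DRESSED + O(δ²)·MASS**: `curlSq 1 ψ [0,P)^d ≤ 2·curlSq V ψ [0,P)^d + 8192·d·δ²·dirSq ψ [0,P)^d`. [folklore] -/
theorem curlSq_flat_le_two [Nonempty n] {V : Site d → Fin d → (Matrix n n ℂ)ˣ} (hV : IsUnitaryCfg V) {δ : ℝ} (hδ : 0 ≤ δ)
    (hVδ : ∀ (x : Site d) (μ : Fin d), ‖((V x μ : (Matrix n n ℂ)ˣ) : Matrix n n ℂ) - 1‖ ≤ δ) {P : ℕ} (hP : 1 ≤ P)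
    {ψ : Site d → Fin d → Matrix n n ℂ} (hψ : IsPeriodicDir ψ (P : ℤ)) :
    curlSq (flat (d := d) (n := n)) ψ (periodBox (d := d) P) ≤ 2 * curlSq V ψ (periodBox (d := d) P) + 8192 * d * δ ^ 2 * dirSq ψ (periodBox (d := d) P) := by
  have hD := curlSq_sub_flat_le hV hδ hVδ hP hψ
  unfold curlSq at hD ⊢
  have hpt : ∀ (x : Site d) (π : T4AveragingDeficitWall.Plane d),
      ‖curl (flat (d := d) (n := n)) ψ (x, π)‖ ^ 2 ≤ 2 * ‖curl V ψ (x, π)‖ ^ 2 + 2 * ‖curl V ψ (x, π) - curl (flat (d := d) (n := n)) ψ (x, π)‖ ^ 2 := by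
    intro x π
    have h := norm_sub_le (curl V ψ (x, π)) (curl V ψ (x, π) - curl (flat (d := d) (n := n)) ψ (x, π))
    rw [sub_sub_cancel] at h
    nlinarith [h, norm_nonneg (curl V ψ (x, π)), norm_nonneg (curl (flat (d := d) (n := n)) ψ (x, π)), norm_nonneg (curl V ψ (x, π) - curl (flat (d := d) (n := n)) ψ (x, π)),
      sq_nonneg (‖curl V ψ (x, π)‖ - ‖curl V ψ (x, π) - curl (flat (d := d) (n := n)) ψ (x, π)‖)]
  calc ∑ z ∈ periodBox (d := d) P, ∑ π : T4AveragingDeficitWall.Plane d, ‖curl (flat (d := d) (n := n)) ψ (z, π)‖ ^ 2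
      ≤ ∑ z ∈ periodBox (d := d) P, ∑ π : T4AveragingDeficitWall.Plane d,
          (2 * ‖curl V ψ (z, π)‖ ^ 2 + 2 * ‖curl V ψ (z, π) - curl (flat (d := d) (n := n)) ψ (z, π)‖ ^ 2) :=
        Finset.sum_le_sum fun z _ => Finset.sum_le_sum fun π _ => hpt z π
    _ = 2 * ∑ z ∈ periodBox (d := d) P, ∑ π : T4AveragingDeficitWall.Plane d, ‖curl V ψ (z, π)‖ ^ 2
        + 2 * ∑ z ∈ periodBox (d := d) P, ∑ π : T4AveragingDeficitWall.Plane d, ‖curl V ψ (z, π) - curl (flat (d := d) (n := n)) ψ (z, π)‖ ^ 2 := by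
        simp only [Finset.sum_add_distrib, Finset.mul_sum]
    _ ≤ _ := by nlinarith [hD]

/-! ## §2 The curved one-step curl letter at `d = 4`, `L = 2` -/

section Letter

variable [Nonempty n] {W : Site 4 → Fin 4 → (Matrix n n ℂ)ˣ} {x : ℝ} (hWu : IsUnitaryCfg W) (hx : 0 ≤ x) (hs : LevelSmall 4 2 0 x)
  (hWx : SmallField W x) (N : ℕ) [NeZero N] (hθ : cruxC 4 2 * ((((2 : ℕ) : ℝ) ^ (0 + 1)) ^ 2 * x) < 1)
  (hE : 4 * ((4 : ℕ) : ℝ) ^ 2 * (((2 : ℕ) : ℝ) ^ (0 + 1) - 1) ^ 2 * x + 16 * (4 : ℕ) * loopRad 4 2 ((prop1Radius 4 2)^[0] x) ≤ 1 / 2)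

/-- **THE CURL REMAINDER CONSTANT** of the curved one-step lift (explicit polynomial in `x`, `b`, the class constants). [folklore] -/
def curlRemC (n : Type*) [Fintype n] (x b : ℝ) : ℝ :=
  134217728 * (64 * 5 * 8 * 4 * x + 2 * b) ^ 2
    + (Kmain n + Dgauge n) ^ 2 * rho ^ 2 * (131072 * b ^ 2 + 2 * liftCurlC 4 2 * defC 4 2 * (defA 4 2 * x + defB 4 2 * b) ^ 2)

/-- **(L2_W) — THE CURVED ONE-STEP CURL LETTER** (`d = 4`, `L = 2`; `W` `(2N)`-periodic one-level class background with bondwise radius `b`; `w` skew `N`-periodic):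
`curlSq W (r_W w) [0,2N)⁴ ≤ 8192·curlSq (cavg 2 W) w [0,N)⁴ + curlRemC(x,b)·dirSq w [0,N)⁴`. [folklore] -/
theorem curlSq_curvedLift_le (hWP : IsPeriodicCfg W ((tower 2 N (0 + 1) : ℕ) : ℤ))
    (hθl2 : thetaLoc 4 2 * ((((2 : ℕ) : ℝ) ^ (0 + 1)) ^ 2 * x) ≤ 1 / 2) (hε : (((2 : ℕ) : ℝ) ^ (0 + 1)) ^ 2 * x ≤ 1)
    {b : ℝ} (hb : 0 ≤ b) (hWb : ∀ (y : Site 4) (μ : Fin 4), ‖((W y μ : (Matrix n n ℂ)ˣ) : Matrix n n ℂ) - 1‖ ≤ b)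
    {w : Site 4 → Fin 4 → Matrix n n ℂ} (hw : IsSkewDir w) (hwP : IsPeriodicDir w (N : ℤ)) :
    curlSq W (curvedLift (by norm_num) hWu hx hs hWx N hθ hE hw) (periodBox (d := 4) (2 * N))
      ≤ 8192 * curlSq (cavg 2 W) w (periodBox (d := 4) N) + curlRemC n x b * dirSq w (periodBox (d := 4) N) := by
  have hN : 1 ≤ N := Nat.one_le_iff_ne_zero.mpr (NeZero.ne N)
  have h2N : 1 ≤ 2 * N := by omega
  obtain ⟨h512, hWbu, hr0, hWbx⟩ := step_small (d := 4) (by norm_num : 1 ≤ 2) hWu hx hs.two hWx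
  have hWP' : IsPeriodicCfg W ((2 : ℤ) * N) := by
    have h : (((tower 2 N (0 + 1) : ℕ) : ℤ)) = (2 : ℤ) * N := by simp [tower]
    rw [h] at hWP; exact hWP
  have hδs := isSkewDir_defect (d := 4) (by norm_num : 2 ≤ 2) hWu hx hs hWx N hw
  -- periodicity of the pieces
  have hrP : IsPeriodicDir (exactLift 2 N w) ((2 * N : ℕ) : ℤ) := fun z j κ' => exactLift_periodic (d := 4) (n := n) (by norm_num : 1 ≤ 2) N (fun y' j' κ'' => hwP y' j' κ'') z j κ'
  have hrP' : IsPeriodicDir (exactLift 2 N w) ((2 : ℤ) * N) := fun z j κ' => by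
    have h := hrP z j κ'; rw [show (((2 * N : ℕ) : ℤ)) = (2 : ℤ) * N by push_cast; ring] at h; exact h
  -- the decomposition `r_W = r − R₀ δ`
  set R0 : Site 4 → Fin 4 → Matrix n n ℂ := rightInvW0 (d := 4) (by norm_num) 0 hWu hx hs hWx N hθ hE hδs with hR0
  have hdec : curvedLift (by norm_num) hWu hx hs hWx N hθ hE hw = exactLift 2 N w - R0 := by
    funext y ν; simp only [curvedLift, Pi.sub_apply, hR0]
  -- (1) curl of `r w` at `W`: dressed ≤ 2 flat + mass
  have h1 := curlSq_le_two_flat (d := 4) hWu hb hWb h2N hrP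
  have h1f := curlSq_exactLift_le_four_two (n := n) hN (fun y j κ => hwP y j κ)
  rw [show (flatCfg : Site 4 → Fin 4 → (Matrix n n ℂ)ˣ) = flat from rfl] at h1f
  -- flat curl of `w` ≤ 2 dressed (coarse background) + mass; bondwise radius of `cavg 2 W`
  have hcb : ∀ (y : Site 4) (μ : Fin 4), ‖((cavg 2 W y μ : (Matrix n n ℂ)ˣ) : Matrix n n ℂ) - 1‖ ≤ 64 * 5 * 8 * 4 * x + 2 * b := by
    intro y μ
    have h := norm_bavg_sub_one_le_of_bonds' (d := 4) (by norm_num : 1 ≤ 2) hWu hx h512 hWx hWb ((2 : ℤ) • y) μ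
    have e1 : (cavg 2 W y μ : (Matrix n n ℂ)ˣ) = bavg 2 W ((2 : ℤ) • y) μ := rfl
    rw [e1]
    refine h.trans (le_of_eq ?_); norm_num
  have hcb0 : 0 ≤ 64 * 5 * 8 * 4 * x + 2 * b := by positivity
  have h2 := curlSq_flat_le_two (d := 4) hWbu hcb0 hcb hN hwP
  -- (2) curl of the correction
  have hRcurl := curlSq_rightInvW0_class_le (d := 4) (by norm_num : 2 ≤ 2) 0 hWu hx hs hWx N hθ hE hWP hθl2 hε hδs
  rw [show periodBox (d := 4) (N * 2 ^ (0 + 1)) = periodBox (d := 4) (2 * N) by rw [show N * 2 ^ (0 + 1) = 2 * N by ring]] at hRcurl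
  have hδeq : defect (L := 2) (W := W) N w = fun z κ => cpush 2 W (exactLift 2 N w) z κ - cpush 2 (flatCfg (d := 4) (n := n)) (exactLift 2 N w) z κ := by
    funext z κ; simp only [defect]; rw [cpush_exactLift (by norm_num : 1 ≤ 2) hN (fun y j κ => hwP y j κ)]
  have hD := dirSq_cpush_sub_cpush_flat_le (d := 4) (by norm_num : 1 ≤ 2) hN hWu hx h512 hWx hb hWb hrP'
  rw [← hδeq] at hD
  -- (3) the flat one-step mass letter (C) with `m = 1`
  have hC := dirSq_liftIter_le (n := n) hN (fun y j κ => hwP y j κ) 1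
  simp only [liftIter, pow_zero, one_mul, pow_one] at hC
  -- assemble
  have m0 : 0 ≤ dirSq w (periodBox (d := 4) N) := dirSq_nonneg _ _
  have mr0 : 0 ≤ dirSq (exactLift 2 N w) (periodBox (d := 4) (2 * N)) := dirSq_nonneg _ _
  have c0 : 0 ≤ curlSq (cavg 2 W) w (periodBox (d := 4) N) := curlSq_nonneg _ _ _
  have cf0 : 0 ≤ curlSq (flat (d := 4) (n := n)) w (periodBox (d := 4) N) := curlSq_nonneg _ _ _
  have hlc := liftCurlC_nonneg 4 2
  have hdC := defC_nonneg 4 2; have hA := defA_nonneg 4 2; have hB := defB_nonneg 4 2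
  have hK := Kmain_nonneg (n := n); have hDg := Dgauge_nonneg (n := n); have hρ := rho_nonneg
  have hKD2 : 0 ≤ (Kmain n + Dgauge n) ^ 2 * rho ^ 2 := by positivity
  have hsplit := curlSq_sub_le W (exactLift 2 N w) R0 (periodBox (d := 4) (2 * N))
  rw [hdec]
  have hmassr : dirSq (exactLift 2 N w) (periodBox (d := 4) (2 * N)) ≤ (Kmain n + Dgauge n) ^ 2 * rho ^ 2 * dirSq w (periodBox (d := 4) N) := by simpa using hC
  -- abbreviations
  set A : ℝ := curlSq W (exactLift 2 N w) (periodBox (d := 4) (2 * N)) with hAdef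
  set B : ℝ := curlSq W R0 (periodBox (d := 4) (2 * N)) with hBdef
  set C : ℝ := curlSq (cavg 2 W) w (periodBox (d := 4) N) with hCdef
  set F : ℝ := curlSq (flat (d := 4) (n := n)) w (periodBox (d := 4) N) with hFdef
  set m : ℝ := dirSq w (periodBox (d := 4) N) with hmdef
  set Mr : ℝ := dirSq (exactLift 2 N w) (periodBox (d := 4) (2 * N)) with hMrdef
  set KD : ℝ := (Kmain n + Dgauge n) ^ 2 * rho ^ 2 with hKDdef
  set G : ℝ := 64 * 5 * 8 * 4 * x + 2 * b with hGdef
  set E : ℝ := defA 4 2 * x + defB 4 2 * b with hEdef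
  -- (1): `A ≤ 2048 F + 32768 b² Mr`, `F ≤ 2 C + 32768 G² m`, `Mr ≤ KD m`
  have e1 : A ≤ 2048 * F + 32768 * (b ^ 2 * Mr) := by
    have h := h1; push_cast at h
    have hf : curlSq (flat (d := 4) (n := n)) (exactLift 2 N w) (periodBox (d := 4) (2 * N)) ≤ 1024 * F := h1f
    have hb2 : 0 ≤ b ^ 2 := sq_nonneg b
    have : 8192 * (4 : ℝ) * b ^ 2 * Mr = 32768 * (b ^ 2 * Mr) := by ring
    linarith [h, hf]
  have e2 : F ≤ 2 * C + 32768 * (G ^ 2 * m) := by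
    have h := h2; push_cast at h
    have : 8192 * (4 : ℝ) * G ^ 2 * m = 32768 * (G ^ 2 * m) := by ring
    linarith [h]
  have e3 : b ^ 2 * Mr ≤ b ^ 2 * (KD * m) := mul_le_mul_of_nonneg_left hmassr (sq_nonneg b)
  have hP1 : A ≤ 4096 * C + (67108864 * G ^ 2 + 32768 * b ^ 2 * KD) * m := by
    have : (67108864 * G ^ 2 + 32768 * b ^ 2 * KD) * m = 67108864 * (G ^ 2 * m) + 32768 * (b ^ 2 * (KD * m)) := by ring
    linarith [e1, e2, e3]
  -- (2): `B ≤ liftCurlC · defC · E² · KD · m`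
  have hP2 : B ≤ liftCurlC 4 2 * (defC 4 2 * E ^ 2 * (KD * m)) := by
    have f1 : B ≤ liftCurlC 4 2 * dirSq (defect (L := 2) (W := W) N w) (periodBox (d := 4) N) := by
      refine hRcurl.trans (le_of_eq ?_); norm_num
    have f2 : dirSq (defect (L := 2) (W := W) N w) (periodBox (d := 4) N) ≤ defC 4 2 * E ^ 2 * (KD * m) :=
      hD.trans (mul_le_mul_of_nonneg_left hmassr (by positivity))
    exact f1.trans (mul_le_mul_of_nonneg_left f2 hlc)
  -- the remainder constant dominates
  have hrem : 2 * (67108864 * G ^ 2 + 32768 * b ^ 2 * KD) + 2 * (liftCurlC 4 2 * defC 4 2 * E ^ 2 * KD) ≤ curlRemC n x b := by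
    have hslack : 0 ≤ 65536 * b ^ 2 * KD := by positivity
    have heq : curlRemC n x b = 2 * (67108864 * G ^ 2 + 32768 * b ^ 2 * KD) + 2 * (liftCurlC 4 2 * defC 4 2 * E ^ 2 * KD) + 65536 * b ^ 2 * KD := by
      unfold curlRemC; rw [hKDdef, hGdef, hEdef]; ring
    linarith
  calc curlSq W (exactLift 2 N w - R0) (periodBox (d := 4) (2 * N)) ≤ 2 * A + 2 * B := hsplit
    _ ≤ 2 * (4096 * C + (67108864 * G ^ 2 + 32768 * b ^ 2 * KD) * m) + 2 * (liftCurlC 4 2 * (defC 4 2 * E ^ 2 * (KD * m))) := by linarith [hP1, hP2]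
    _ = 8192 * C + (2 * (67108864 * G ^ 2 + 32768 * b ^ 2 * KD) + 2 * (liftCurlC 4 2 * defC 4 2 * E ^ 2 * KD)) * m := by ring
    _ ≤ 8192 * C + curlRemC n x b * m := by
        have := mul_le_mul_of_nonneg_right hrem m0
        linarith

end Letter

end

end Summit.QuantumFields.BalabanUV.T4Continuum.NE7CurvedExactLiftCurl
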